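import Mathlib
import Summits.Schanuel.Schanuel.Theses.GaussianStokesSector
import Summits.Schanuel.Schanuel.Theorems.RigidCoreSchanuelOnLogFreeCoreSectorSplit

/-!
# Line `sector-split` (route `RigidCore`): calibration — the sector factorisation of Schanuel
# is exact

Prover file for the registered stub `stub_exactness` of line `sector-split` (v6) of crux
`stmt-Schanuel-0970` (`Summit.Schanuel.Schanuel.Theses.RigidCore.SchanuelOnLogFreeCore`, "(R)":
Schanuel's statement for `ℚ`-linearly independent tuples from the log-free core `C_EA`).  It is
verbatim the support item stmt-Schanuel-9556 `GaussianStokesSector.Exactness` of the routes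
GaussianStokesSector / ExceptionalSubspaces:

  **`Schanuel → PiFreeOverLWField ∧ RelSchanuelOverPiLWField`**,

i.e. the factorisation of the summit along the `ℚ`-subspace `V₂ = E := span_ℚ(ℚ̄ ∪ {πi})`,
over the π–LW field `K₂ = L := ℚ(ℚ̄ ∪ {πi} ∪ e^{ℚ̄})`, loses nothing (the converse direction
`Assembly`, item stmt-Schanuel-9557, is the landed `SectorGlue.gaussianStokesSector_assembly`;
together: `SectorExactness.schanuel_iff_piFree_and_relSchanuel`).

* Conjunct 1 (`PiFreeOverLWField`, item stmt-Schanuel-9545) is the landed calibration chain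
  `Schanuel ⟹ (R) ⟹ PiFreeOverLWField` (`SectorSplit.calibration`:
  `Sandwich.crux_of_schanuelConjecture`, `KernelTower.piFreeOverLWField_of_schanuelOnLogFreeCore`).
* Conjunct 2 (`RelSchanuelOverPiLWField`, item stmt-Schanuel-9548, for ALL tuples `x` free
  modulo `E`, not only core tuples) is the hull count of `SectorExact.le_trdeg_of_crux`
  (`RigidCoreSchanuelOnLogFreeCoreSectorExact`; M. Bays, J. Kirby, *Pseudo-exponential maps,
  variants, and quasiminimality*, Algebra & Number Theory 12 (2018), arXiv:1512.04262, §9;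
  J. Kirby, *Exponential algebraicity in exponential fields*, Bull. LMS 42 (2010), §3;
  M. Waldschmidt, *Diophantine Approximation on Linear Algebraic Groups* (2000), §1.4) with the
  core-membership hypothesis on `x` removed (`SectorExactness.le_trdeg_of_schanuel`): Schanuel's
  conjecture is strongness of the zero subspace, `δ(X/0) ≥ 0` for EVERY finitely generated
  `ℚ`-subspace `X ≤ ℂ` (`ZilberHomogeneity.isStrong_bot_of_schanuelProperty`;
  `SchanuelProperty ℂ` is `Schanuel` by `rfl`), which is the only place where
  `le_trdeg_of_crux` used `x ⊂ C_EA`; the hulls INSIDE `E` of the generators of `L` (an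
  algebraic number: `0`; `πi`: `ℚπi`; `e^c`, `c` algebraic: `ℚc`) and their common hull are
  taken from the landed file through (R), which Schanuel implies.  Count: with `J` a basis of
  `T = x ∪ eˣ` over the generators `G` of `L` in the algebraic matroid, a finite `I ⊆ J ∪ G`
  with `T ⊆ acl I` (finite character) and a common hull `V ≤ E` of `I ∩ G`,
  `n = ldim(X/E) ≤ ldim(X/V) ≤ td(X/V) ≤ relRank(T / gens V) ≤ |J| = trdeg_L L(T)`
  (`δ(X/V) = δ(V ⊔ X/0) - δ(V/0) ≥ 0`).
No new definitions; everything used is proved in the tree; Schanuel is the hypothesis.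
-/

noncomputable section

namespace Summit.Schanuel.Schanuel.Theorems.RigidCore

open Set Literature.NumberTheory.Transcendental Literature.NumberTheory.Transcendental.GammaField
open Summit.Schanuel.Schanuel.Theses

namespace SectorExactness

/-- **Schanuel's conjecture is strongness of the zero subspace**: under `Schanuel`,
`δ(X/0) = td(X/0) - ldim(X/0) ≥ 0` for every finitely generated `ℚ`-subspace `X ≤ ℂ`
(`SchanuelProperty ℂ` is definitionally `Schanuel`). [cite: BaysKirby2018ANT, Thm 9.1 (proof)] -/
theorem isStrong_bot_of_schanuel (hS : Schanuel) : IsStrong (⊥ : Submodule ℚ ℂ) :=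
  ZilberHomogeneity.isStrong_bot_of_schanuelProperty hS

/-- **`Schanuel ⟹ RelSchanuelOverPiLWField`, transcendence-degree form**: for ANY tuple `x`
free modulo `E = span(ℚ̄ ∪ {πi})`, `n ≤ trdeg_L L(x, eˣ)` over the π–LW field
`L = ℚ(ℚ̄ ∪ {πi} ∪ e^{ℚ̄})`.  Hull count of `SectorExact.le_trdeg_of_crux` with `δ ≥ 0` on all
finitely generated subspaces of `ℂ` (Schanuel) in place of `δ ≥ 0` inside the core ((R)): with
`J` a basis of `T = x ∪ eˣ` over the generators `G` of `L` in the algebraic matroid, a finite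
`I ⊆ J ∪ G` with `T ⊆ acl I` and a common hull `V ≤ E` of `I ∩ G` (hulls through (R), which
Schanuel implies, `SectorSplit.calibration`),
`n = ldim(X/E) ≤ ldim(X/V) ≤ td(X/V) ≤ relRank(T / gens V) ≤ |J| = trdeg_L L(T)`.
[cite: BaysKirby2018ANT, §9] -/
theorem le_trdeg_of_schanuel (hS : Schanuel) (n : ℕ) (x : Fin n → ℂ)
    (hli : LinearIndependent ℚ
      ((Submodule.span ℚ ({z : ℂ | IsAlgebraic ℚ z} ∪ {(Real.pi : ℂ) * Complex.I})).mkQ ∘ x)) :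
    (n : Cardinal) ≤ Algebra.trdeg
      ↥(IntermediateField.adjoin ℚ ({z : ℂ | IsAlgebraic ℚ z} ∪ {(Real.pi : ℂ) * Complex.I} ∪
        Complex.exp '' {z : ℂ | IsAlgebraic ℚ z}))
      ↥(IntermediateField.adjoin ↥(IntermediateField.adjoin ℚ ({z : ℂ | IsAlgebraic ℚ z} ∪
        {(Real.pi : ℂ) * Complex.I} ∪ Complex.exp '' {z : ℂ | IsAlgebraic ℚ z}))
        (range x ∪ range (Complex.exp ∘ x))) := by
  have hR : RigidCore.SchanuelOnLogFreeCore := SectorSplit.calibration.1 hS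
  have hstr : IsStrong (⊥ : Submodule ℚ ℂ) := isStrong_bot_of_schanuel hS
  set E : Submodule ℚ ℂ :=
    Submodule.span ℚ ({z : ℂ | IsAlgebraic ℚ z} ∪ {(Real.pi : ℂ) * Complex.I}) with hE
  set G : Set ℂ := {z : ℂ | IsAlgebraic ℚ z} ∪ {(Real.pi : ℂ) * Complex.I} ∪
    Complex.exp '' {z : ℂ | IsAlgebraic ℚ z} with hG
  set K : IntermediateField ℚ ℂ := IntermediateField.adjoin ℚ G with hK
  set T : Set ℂ := range x ∪ range (Complex.exp ∘ x) with hT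
  set X : Submodule ℚ ℂ := Submodule.span ℚ (range x) with hX
  have hTfin : T.Finite := (finite_range x).union (finite_range _)
  have hKG : (algMatroid ℂ).closure (K : Set ℂ) = (algMatroid ℂ).closure G := acl_adjoin G
  -- (1) finite character: a basis `J` of `T` over `G` and a finite `I ⊆ J ∪ G` spanning `T`
  obtain ⟨J, hJ⟩ := ((algMatroid ℂ).contract G).exists_isBasis' T
  have hρ : (algMatroid ℂ).relRank G T = J.encard := by
    rw [Matroid.relRank_eq_eRk_contract, hJ.encard_eq_eRk]
  have hTclJ : T ⊆ (algMatroid ℂ).closure (J ∪ G) := fun a haT => by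
    by_cases haM : a ∈ G
    · exact (algMatroid ℂ).subset_closure _ (fun _ _ => mem_univ _) (Or.inr haM)
    · have haE : a ∈ ((algMatroid ℂ).contract G).E := by
        rw [Matroid.contract_ground]; exact ⟨mem_univ a, haM⟩
      have h1 := ((algMatroid ℂ).contract G).inter_ground_subset_closure T ⟨haT, haE⟩
      rw [← hJ.closure_eq_closure, Matroid.contract_closure_eq] at h1
      exact h1.1
  obtain ⟨I, hIJG, hIfin, -, hTI⟩ :=
    (algMatroid ℂ).exists_subset_finite_closure_of_subset_closure hTfin hTclJ
  -- (2) a common hull `V ≤ E` of the finitely many generators in `I` (through (R))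
  obtain ⟨V, hV, hVfg, hV0, hcV⟩ := RelLWStep.exists_common_hull hR
    SectorExact.span_alg_pi_le_eaFibre (hIfin.inter_of_left G)
    fun a ha => SectorExact.exists_hull_of_mem_gens hR ha.2
  -- (3) over `gens V` the set `T` has relative rank `≤ |J| = relRank (T / G)`
  have hle1 : (algMatroid ℂ).relRank (gens V) T ≤ J.encard := by
    have hTcl : T ⊆ (algMatroid ℂ).closure (J ∪ gens V) := by
      refine hTI.trans ((algMatroid ℂ).closure_subset_closure_of_subset_closure fun a ha => ?_)
      rcases hIJG ha with haJ | haG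
      · exact (algMatroid ℂ).subset_closure (J ∪ gens V) (fun _ _ => mem_univ _) (Or.inl haJ)
      · exact (algMatroid ℂ).closure_subset_closure subset_union_right (hcV ⟨ha, haG⟩)
    calc (algMatroid ℂ).relRank (gens V) T ≤ (algMatroid ℂ).relRank (gens V) J :=
          (algMatroid ℂ).relRank_le_of_subset_closure _ hTcl
      _ ≤ (J \ gens V).encard := (algMatroid ℂ).relRank_le_encard_diff _ _
      _ ≤ J.encard := encard_le_encard sdiff_subset
  -- (4) `td(X/V) ≤ relRank (T / gens V)`; (5) `δ(X/V) ≥ 0` (Schanuel: `0 ◁ ℂ`);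
  -- (6) `ldim(X/V) ≥ ldim(X/E) = n`
  have htdle : td V X ≤ (algMatroid ℂ).relRank (gens V) T := by
    have h := td_span_le_relRank V (range x)
    rw [← range_comp] at h
    exact h
  have hXfg : IsFG (⊥ : Submodule ℚ ℂ) X := isFG_span_of_finite ⊥ (finite_range x)
  have hVXfg : IsFG (⊥ : Submodule ℚ ℂ) (V ⊔ X) := hVfg.sup hXfg
  have hpVX : 0 ≤ predim ⊥ (V ⊔ X) := hstr bot_le hVXfg
  rw [predim_add bot_le le_sup_left hVXfg, predim_sup_left, hV0, zero_add, predim_def] at hpVX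
  have hldimE : ldim E X = n := by
    rw [ldim, hX, Submodule.map_span, ← range_comp, finrank_span_eq_card hli, Fintype.card_fin]
  have hldim : n ≤ ldim V X := by
    have h := ldim_add (inf_le_inf_left X hV) inf_le_left (hXfg.of_le_left bot_le)
    rw [← ldim_eq_ldim_inf X V, ← ldim_eq_ldim_inf X, hldimE] at h
    omega
  -- (7) `n ≤ ldim(X/V) ≤ td(X/V) ≤ relRank (T / gens V) ≤ |J| = relRank (T / G) = trdeg_L L(T)`
  refine Cardinal.natCast_le_toENat.1 ?_
  rw [toENat_trdeg_adjoin_eq_relRank K T, (algMatroid ℂ).relRank_congr_closure_left T hKG, hρ]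
  calc (n : ℕ∞) ≤ ((td V X).toNat : ℕ∞) := ENat.coe_le_coe.2 (by omega)
    _ = td V X := ENat.coe_toNat (td_ne_top (hXfg.of_le_left bot_le))
    _ ≤ J.encard := htdle.trans hle1

/-- **The unrestricted sector split of the summit is exact**:
`Schanuel ⟺ PiFreeOverLWField ∧ RelSchanuelOverPiLWField`.  `⟹`: conjunct 1 (item
stmt-Schanuel-9545) through (R) by the landed calibration chain `SectorSplit.calibration`
(`Sandwich.crux_of_schanuelConjecture`, `KernelTower.piFreeOverLWField_of_schanuelOnLogFreeCore`);
conjunct 2 (item stmt-Schanuel-9548, verbatim) is `le_trdeg_of_schanuel`.  `⟸`: the landed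
assembly `SectorGlue.gaussianStokesSector_assembly` (item stmt-Schanuel-9557).
[cite: BaysKirby2018ANT, §9] -/
theorem schanuel_iff_piFree_and_relSchanuel :
    Schanuel ↔
      GaussianStokesSector.PiFreeOverLWField ∧ GaussianStokesSector.RelSchanuelOverPiLWField :=
  ⟨fun hS => ⟨SectorSplit.calibration.2.1 (SectorSplit.calibration.1 hS),
      fun n x hli => le_trdeg_of_schanuel hS n x hli⟩,
    fun h => SectorGlue.gaussianStokesSector_assembly h.1 h.2⟩

end SectorExactness

/-- **Registered stub `stub_exactness` of line `sector-split` — the sector factorisation of the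
summit loses nothing** (= item stmt-Schanuel-9556 `GaussianStokesSector.Exactness`, signature
verbatim): `Schanuel → PiFreeOverLWField ∧ RelSchanuelOverPiLWField`.  Conjunct 1 through (R)
(`SectorSplit.calibration`), conjunct 2 by the hull count
`SectorExactness.le_trdeg_of_schanuel`; the forward direction of
`SectorExactness.schanuel_iff_piFree_and_relSchanuel`. [cite: BaysKirby2018ANT, §9] -/
theorem stub_exactness : GaussianStokesSector.Exactness :=
  SectorExactness.schanuel_iff_piFree_and_relSchanuel.1

end Summit.Schanuel.Schanuel.Theorems.RigidCore

end
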